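import Literature.MathematicalPhysics.QuantumLattice.GibbsTwoSectorEnergyEntropyBalance
import Literature.MathematicalPhysics.QuantumLattice.TorusGibbsEnergyEntropyBalance
import Literature.MathematicalPhysics.QuantumLattice.SectorPartitionFnCut
import Literature.MathematicalPhysics.QuantumLattice.HubbardSzSectorLadder
import HarnessLib

/-!
# The two-sector (charged) energy–entropy balance rows for the canonical Gibbs states of the `t–t'`
# Hubbard torus in its spin sectors `(N↑, N↓) = (a, b)`: canonical chemical potentials at `T > 0`,
# finite volume

Topic `Literature/MathematicalPhysics/QuantumLattice`; torus companion of
`GibbsTwoSectorEnergyEntropyBalance.lean` (the two-sector Araki–Sewell rows for two invariant coordinate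
sectors of a Hermitian matrix) in the format of `TorusGibbsEnergyEntropyBalance.lean` (the ONE-sector
rows, for generators conserving `N` and `S^z`, in the translated eigen-mixtures `(p_{L,i}, U_v ψ_{L,i})`
of the canonical Gibbs data). Written for the `T > 0` certificate family of the Hubbard programme, whose
reader law (hubbard-thermal READER-LAW §3) lists the CHARGED energy–entropy-balance rows — generators
changing `N` or `S^z`, carrying the chemical potential — as NOT kernel-valid for the thermal object of
record (torus limits of canonical sector Gibbs states): they hold for the grand-canonical KMS object,
and equivalence of ensembles is not in the tree. What IS true for the canonical object, exactly and at
every finite volume, is the two-sector row: for `H_L = hubbardTorusTT' L t t' U`, a torus operator `B`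
carrying the spin sector `(a, b)` into `(a', b')` and `Bᴴ` carrying `(a', b')` back (a generator of
definite charge `(a' − a, b' − b)`), the canonical eigen-data `(E_c, ψ_c)` of `H_L|_{(a,b)}` and
`(E'_d, ψ'_d)` of `H_L|_{(a',b')}`, every translation `U_v`, and all real `β, s, q` with `e^{s−1} ≤ q`:

  `0 ≤ Σ_c e^{−βE_c} Re⟨U_vψ_c, (β·Bᴴ(H_L B − B H_L) − s·BᴴB) U_vψ_c⟩
        + q · Σ_d e^{−βE'_d} Re⟨U_vψ'_d, BBᴴ U_vψ'_d⟩`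

(§2, `sum_exp_mul_re_expect_twoSector_eeb_fockTranslate_nonneg`; §1 is the generic covariance step), and
after normalisation (`…canonicalWeight…`) the grand-canonical row with `e^{βμ}` replaced by the ratio of
CANONICAL partition functions `Z_{(a',b')}/Z_{(a,b)}`, `Z_{(a,b)} = Σ_c e^{−βE_c} = Re Z_β(H_L|_{(a,b)})`
(`partitionFn_spinSectorHamiltonian_re`, `SectorPartitionFnCut`), and `BBᴴ` read in the image sector. §3 restates the brackets
`log(x/y') − βh/x ≤ log(Z_{(a',b')}/Z_{(a,b)}) ≤ log(x/y') + βg'/y'` on the canonical chemical potential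
in the partition-function language. The passage to torus-limit states (pairs of limits along a common
side sequence, one per sector, plus a limit point of the ratio) is the business of a companion file; this
one is finite-volume and has no hypothesis on `β, t, t', U, a, b, a', b'`.

HONEST SCOPE: exact finite-volume inequalities for the canonical object; no number, no thermodynamic
limit, no equivalence of ensembles (in particular no claim that the one-particle chemical potentials of
neighbouring sectors agree, or converge). Everything is PROVED; no definition, no named fact, no instance.

## Mathlib / tree search

REUSED: `sum_exp_mul_re_expect_twoSector_eeb_nonneg`, `sum_canonicalWeight_mul_re_expect_twoSector_eeb_nonneg`,
`log_div_sub_div_le_log_partitionRatio`, `log_partitionRatio_le_log_div_add_div`, `mul_apply_eq_zero_off`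
(`Gibbs(TwoSector)EnergyEntropyBalance`); `fockTranslate_val_conjTranspose_mul_val_mul`,
`fockTranslate_val_mul_val_conjTranspose_mul`, `fockTranslate_val_conjTranspose_eq_neg`
(`TorusGibbsEnergyEntropyBalance`); `spinConfig`, `spinSectorHamiltonian`, `apply_eq_zero_of_preservesSectors`,
`partitionFn_spinSectorHamiltonian_re`, `isInSector_iff_support` (`SectorPartitionFnCut`);
`mem_szSector_iff_isInSector` (`HubbardSzSectorLadder`); `fockTranslate_mulVec_mem_szSector`,
`fockTranslate_commute_hubbardTorusTT'`, `apply_eq_zero_off_of_mulVec_mem`,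
`LiebTwoHoppings.preservesSectors_hamiltonian₂`, `star_mulVec_dotProduct_mulVec_mulVec`.
`lean search 'twoSector|charged.*Gibbs|spinConfig.*eeb'`: nothing beyond the companion (2026-08-27).

## References

* O. Bratteli, D. W. Robinson, *Operator Algebras and Quantum Statistical Mechanics 2* (1997),
  Thm. 5.3.15 (Araki–Sewell), §5.4.2 (chemical potential of gauge-invariant KMS states).
  [cite: BratteliRobinsonII1997, Thm. 5.3.15]
* H. Fawzi, O. Fawzi, S. O. Scalet (2024), Thm. 3.1 (the linearised EEB rows).
  [cite: FawziFawziScalet2024, Thm. 3.1]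
* H. Araki, H. Moriya, Rev. Math. Phys. 15 (2003) 93, Def. 6.3 (dKMS at chemical potential `μ` for
  lattice fermions). [cite: ArakiMoriya2003, Def. 6.3]
* E. H. Lieb, Phys. Rev. Lett. 62 (1989) 1201, Remark (2) (`H` conserves `N↑`, `N↓`; spin sectors).
  [cite: LiebPRL1989, Remark (2)]
-/

noncomputable section

namespace Literature.MathematicalPhysics.QuantumLattice

open Matrix Finset HubbardWave0 Literature.Probability.LatticeModels ThermodynamicLimit
open _root_.Filter
open scoped _root_.Topology ComplexOrder BigOperators

/-! ### §1 Covariance: the two-sector rows in unitarily transformed eigen-mixtures -/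

section Covariance

variable {ι : Type*} [Fintype ι] [DecidableEq ι]

omit [DecidableEq ι] in
/-- Conjugating the commutator observable: `Uᴴ (Bᴴ(AB − BA)) U = B̃ᴴ(AB̃ − B̃A)`, `B̃ = UᴴBU`, for
`U` unitary commuting with `A`. [cite: FawziFawziScalet2024, Thm. 3.1] -/
private theorem conjTranspose_mul_commObs_mul {U A : Matrix ι ι ℂ} (hU : ∀ X : Matrix ι ι ℂ, Uᴴ * (U * X) = X)
    (hU' : ∀ X : Matrix ι ι ℂ, U * (Uᴴ * X) = X) (hUA : Commute U A) (B : Matrix ι ι ℂ) :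
    Uᴴ * (Bᴴ * (A * B - B * A)) * U =
      (Uᴴ * B * U)ᴴ * (A * (Uᴴ * B * U) - (Uᴴ * B * U) * A) := by
  have hconj : ∀ Y Z : Matrix ι ι ℂ, Uᴴ * (Y * Z) * U = (Uᴴ * Y * U) * (Uᴴ * Z * U) := by
    intro Y Z
    calc Uᴴ * (Y * Z) * U = Uᴴ * Y * (Z * U) := by simp only [Matrix.mul_assoc]
      _ = Uᴴ * Y * (U * (Uᴴ * (Z * U))) := by rw [hU']
      _ = (Uᴴ * Y * U) * (Uᴴ * Z * U) := by simp only [Matrix.mul_assoc]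
  have hA : Uᴴ * A * U = A := by
    rw [Matrix.mul_assoc, ← hUA.eq, hU]
  have hBt : (Uᴴ * B * U)ᴴ = Uᴴ * Bᴴ * U := by
    rw [conjTranspose_mul, conjTranspose_mul, conjTranspose_conjTranspose, Matrix.mul_assoc]
  rw [hBt]
  simp only [Matrix.mul_sub, Matrix.sub_mul, hconj, hA]

omit [DecidableEq ι] in
/-- `Uᴴ (BᴴB) U = B̃ᴴB̃` and `Uᴴ (BBᴴ) U = B̃B̃ᴴ`, `B̃ = UᴴBU`, for `U` unitary. [folklore] -/
private theorem conjTranspose_mul_sq_mul {U : Matrix ι ι ℂ} (hU' : ∀ X : Matrix ι ι ℂ, U * (Uᴴ * X) = X)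
    (B : Matrix ι ι ℂ) :
    Uᴴ * (Bᴴ * B) * U = (Uᴴ * B * U)ᴴ * (Uᴴ * B * U) ∧
      Uᴴ * (B * Bᴴ) * U = (Uᴴ * B * U) * (Uᴴ * B * U)ᴴ := by
  have hconj : ∀ Y Z : Matrix ι ι ℂ, Uᴴ * (Y * Z) * U = (Uᴴ * Y * U) * (Uᴴ * Z * U) := by
    intro Y Z
    calc Uᴴ * (Y * Z) * U = Uᴴ * Y * (Z * U) := by simp only [Matrix.mul_assoc]
      _ = Uᴴ * Y * (U * (Uᴴ * (Z * U))) := by rw [hU']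
      _ = (Uᴴ * Y * U) * (Uᴴ * Z * U) := by simp only [Matrix.mul_assoc]
  have hBt : (Uᴴ * B * U)ᴴ = Uᴴ * Bᴴ * U := by
    rw [conjTranspose_mul, conjTranspose_mul, conjTranspose_conjTranspose, Matrix.mul_assoc]
  rw [hBt]
  exact ⟨hconj _ _, hconj _ _⟩

variable (p p' : ι → Prop) [DecidablePred p] [DecidablePred p']

/-- **Two-sector rows for unitarily transformed canonical eigen-mixtures.** Under the hypotheses of
`sum_exp_mul_re_expect_twoSector_eeb_nonneg` (two invariant sectors `p`, `p'` of a Hermitian `A`; `B`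
carries `p` into `p'`, `Bᴴ` carries `p'` into `p`), if moreover `U` is unitary, commutes with `A`, and
`U`, `Uᴴ` have no entries from either sector into its complement, then for `e^{s−1} ≤ q`:
`0 ≤ Σ_a e^{−βE_a} Re⟨Uψ_a, (β·Bᴴ(AB − BA) − s·BᴴB) Uψ_a⟩ + q·Σ_b e^{−βE'_b} Re⟨Uψ'_b, BBᴴ Uψ'_b⟩`
(the rows for the transported generator `UᴴBU` in the original mixtures).
[cite: FawziFawziScalet2024, Thm. 3.1] [cite: BratteliRobinsonII1997, Thm. 5.3.15] -/
theorem sum_exp_mul_re_expect_twoSector_eeb_mulVec_nonneg {A : Matrix ι ι ℂ} (hA : A.IsHermitian)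
    (hinv : ∀ i j, ¬ p i → p j → A i j = 0) (hinv' : ∀ i j, ¬ p' i → p' j → A i j = 0)
    {U : Matrix ι ι ℂ} (hU : ∀ X : Matrix ι ι ℂ, Uᴴ * (U * X) = X)
    (hU' : ∀ X : Matrix ι ι ℂ, U * (Uᴴ * X) = X) (hUA : Commute U A)
    (hUp : ∀ i j, ¬ p i → p j → U i j = 0) (hUp' : ∀ i j, ¬ p i → p j → Uᴴ i j = 0)
    (hUq : ∀ i j, ¬ p' i → p' j → U i j = 0) (hUq' : ∀ i j, ¬ p' i → p' j → Uᴴ i j = 0)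
    {B : Matrix ι ι ℂ} (hB : ∀ i j, ¬ p' i → p j → B i j = 0)
    (hB' : ∀ i j, ¬ p i → p' j → Bᴴ i j = 0) (β : ℝ) {s q : ℝ} (hq : Real.exp (s - 1) ≤ q) :
    0 ≤ ∑ a, Real.exp (-(β * sectorEigenvalue p A hA a)) *
        (star (U *ᵥ sectorEigenvector p A hA a) ⬝ᵥ
          ((((β : ℝ) : ℂ) • (Bᴴ * (A * B - B * A)) - ((s : ℝ) : ℂ) • (Bᴴ * B)) *ᵥ
            (U *ᵥ sectorEigenvector p A hA a))).re +
      q * ∑ b, Real.exp (-(β * sectorEigenvalue p' A hA b)) *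
        (star (U *ᵥ sectorEigenvector p' A hA b) ⬝ᵥ
          ((B * Bᴴ) *ᵥ (U *ᵥ sectorEigenvector p' A hA b))).re := by
  -- the transported generator carries the sectors in the same way
  set Bt : Matrix ι ι ℂ := Uᴴ * B * U with hBtdef
  have hBt : (Uᴴ * B * U)ᴴ = Uᴴ * Bᴴ * U := by
    rw [conjTranspose_mul, conjTranspose_mul, conjTranspose_conjTranspose, Matrix.mul_assoc]
  have hB₁ : ∀ i j, ¬ p' i → p j → Bt i j = 0 := by
    intro i j hi hj
    rw [hBtdef, Matrix.mul_apply]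
    refine Finset.sum_eq_zero fun k _ => ?_
    by_cases hk : p k
    · rw [Matrix.mul_apply, Finset.sum_eq_zero, zero_mul]
      intro l _
      by_cases hl : p' l
      · rw [hUq' i l hi hl, zero_mul]
      · rw [hB l k hl hk, mul_zero]
    · rw [hUp k j hk hj, mul_zero]
  have hB₂ : ∀ i j, ¬ p i → p' j → Btᴴ i j = 0 := by
    intro i j hi hj
    rw [hBtdef, hBt, Matrix.mul_apply]
    refine Finset.sum_eq_zero fun k _ => ?_
    by_cases hk : p' k
    · rw [Matrix.mul_apply, Finset.sum_eq_zero, zero_mul]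
      intro l _
      by_cases hl : p l
      · rw [hUp' i l hi hl, zero_mul]
      · rw [hB' l k hl hk, mul_zero]
    · rw [hUq k j hk hj, mul_zero]
  have key := sum_exp_mul_re_expect_twoSector_eeb_nonneg p p' hA hinv hinv' hB₁ hB₂ β hq
  -- covariance, term by term
  have h1 : ∀ ψ : ι → ℂ, star (U *ᵥ ψ) ⬝ᵥ
      ((((β : ℝ) : ℂ) • (Bᴴ * (A * B - B * A)) - ((s : ℝ) : ℂ) • (Bᴴ * B)) *ᵥ (U *ᵥ ψ)) =
      star ψ ⬝ᵥ ((((β : ℝ) : ℂ) • (Btᴴ * (A * Bt - Bt * A)) - ((s : ℝ) : ℂ) • (Btᴴ * Bt)) *ᵥ ψ) := by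
    intro ψ
    rw [star_mulVec_dotProduct_mulVec_mulVec U _ ψ ψ, Matrix.mul_sub, Matrix.sub_mul, Matrix.mul_smul,
      Matrix.smul_mul, Matrix.mul_smul, Matrix.smul_mul, conjTranspose_mul_commObs_mul hU hU' hUA,
      (conjTranspose_mul_sq_mul hU' B).1]
  have h2 : ∀ ψ : ι → ℂ, star (U *ᵥ ψ) ⬝ᵥ ((B * Bᴴ) *ᵥ (U *ᵥ ψ)) = star ψ ⬝ᵥ ((Bt * Btᴴ) *ᵥ ψ) := by
    intro ψ
    rw [star_mulVec_dotProduct_mulVec_mulVec U _ ψ ψ, (conjTranspose_mul_sq_mul hU' B).2]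
  simp_rw [h1, h2]
  exact key

end Covariance

/-! ### §2 The `t–t'` Hubbard torus: two spin sectors `(a, b)` and `(a', b')` -/

section Torus

variable (L : ℕ)

/-- Membership in the joint sector `(N, S^z) = (a + b, (a − b)/2)` is support in `spinConfig a b`.
[cite: LiebPRL1989, proof of Theorem 1] -/
theorem mem_szSector_iff_spinConfig (a b : ℕ) (v : Fock (Orb (FermionTorus 2 L))) :
    v ∈ szSector (a + b) (((a : ℝ) - b) / 2) ↔ ∀ s, ¬ spinConfig a b s → v s = 0 := by
  rw [mem_szSector_iff_isInSector, isInSector_iff_support]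

/-- The `t–t'` torus Hamiltonian has no entries between a spin sector and its complement (it conserves
`N↑` and `N↓`). [cite: LiebPRL1989, Remark (2)] -/
theorem hubbardTorusTT'_apply_eq_zero_of_spinConfig (t t' U : ℝ) (a b : ℕ)
    (s s' : Finset (Orb (FermionTorus 2 L))) (hs : ¬ spinConfig a b s) (hs' : spinConfig a b s') :
    hubbardTorusTT' L t t' U s s' = 0 :=
  apply_eq_zero_of_preservesSectors
    (LiebTwoHoppings.preservesSectors_hamiltonian₂ (fermionTorusGraph 2 L) (fermionTorusDiagGraph L) t t' U)
    a b s s' hs hs'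

/-- **An operator carrying the joint sector `(a, b)` into `(a', b')` has no entries from
`spinConfig a b` into the complement of `spinConfig a' b'`** (test on coordinate vectors).
[cite: Tasaki2020, §2.2] -/
theorem apply_eq_zero_of_spinConfig_of_mulVec_mem {a b a' b' : ℕ}
    {B : Matrix (Finset (Orb (FermionTorus 2 L))) (Finset (Orb (FermionTorus 2 L))) ℂ}
    (hBK : ∀ v ∈ szSector (a + b) (((a : ℝ) - b) / 2),
      B *ᵥ v ∈ szSector (a' + b') (((a' : ℝ) - b') / 2))
    (s s' : Finset (Orb (FermionTorus 2 L))) (hs : ¬ spinConfig a' b' s) (hs' : spinConfig a b s') :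
    B s s' = 0 := by
  classical
  have hej : (Pi.single s' (1 : ℂ) : Fock (Orb (FermionTorus 2 L))) ∈
      szSector (a + b) (((a : ℝ) - b) / 2) := by
    refine (mem_szSector_iff_spinConfig L a b _).2 fun i hi => ?_
    have hne : i ≠ s' := fun h => hi (h ▸ hs')
    rw [Pi.single_apply, if_neg hne]
  have h := (mem_szSector_iff_spinConfig L a' b' _).1 (hBK _ hej) s hs
  rwa [Matrix.mulVec_single_one, Matrix.col_apply] at h

variable [NeZero L]

/-- The translation unitaries have no entries between a spin sector and its complement (they preserve
every joint sector). [cite: BratteliRobinsonII1997, §5.2.2, Thm. 5.2.5] -/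
theorem fockTranslate_apply_eq_zero_of_spinConfig (v : TorusSite 2 L) (a b : ℕ)
    (s s' : Finset (Orb (FermionTorus 2 L))) (hs : ¬ spinConfig a b s) (hs' : spinConfig a b s') :
    (fockTranslate v).val s s' = 0 :=
  apply_eq_zero_of_spinConfig_of_mulVec_mem L (fun _ hw => fockTranslate_mulVec_mem_szSector v hw)
    s s' hs hs'

/-- Same for the adjoint translation `U_vᴴ = U_{−v}`. [cite: BratteliRobinsonII1997, §5.2.2, Thm. 5.2.5] -/
theorem fockTranslate_conjTranspose_apply_eq_zero_of_spinConfig (v : TorusSite 2 L) (a b : ℕ)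
    (s s' : Finset (Orb (FermionTorus 2 L))) (hs : ¬ spinConfig a b s) (hs' : spinConfig a b s') :
    (fockTranslate v).valᴴ s s' = 0 := by
  rw [fockTranslate_val_conjTranspose_eq_neg]
  exact fockTranslate_apply_eq_zero_of_spinConfig L (-v) a b s s' hs hs'

/-- **Two-sector (charged) energy–entropy balance rows for the translated canonical Gibbs mixtures of
the `t–t'` torus.** Let `H_L = hubbardTorusTT' L t t' U`, let `B` be a torus operator carrying the joint
sector `(a, b)` into `(a', b')` with `Bᴴ` carrying `(a', b')` into `(a, b)` (a generator of definite
charge), let `(E_c, ψ_c)`, `(E'_d, ψ'_d)` be the eigen-data of the compressions of `H_L` to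
`spinConfig a b`, `spinConfig a' b'`, and `U_v` a translation. For all real `β, s, q` with
`e^{s−1} ≤ q`:
`0 ≤ Σ_c e^{−βE_c} Re⟨U_vψ_c, (β·Bᴴ(H_L B − B H_L) − s·BᴴB) U_vψ_c⟩ + q·Σ_d e^{−βE'_d} Re⟨U_vψ'_d, BBᴴ U_vψ'_d⟩`.
No hypothesis on `β, t, t', U` or the sectors. [cite: FawziFawziScalet2024, Thm. 3.1]
[cite: BratteliRobinsonII1997, Thm. 5.3.15] -/
theorem sum_exp_mul_re_expect_twoSector_eeb_fockTranslate_nonneg (t t' U β : ℝ) {a b a' b' : ℕ}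
    (v : TorusSite 2 L) {B : Matrix (Finset (Orb (FermionTorus 2 L))) (Finset (Orb (FermionTorus 2 L))) ℂ}
    (hB : ∀ w ∈ szSector (a + b) (((a : ℝ) - b) / 2), B *ᵥ w ∈ szSector (a' + b') (((a' : ℝ) - b') / 2))
    (hB' : ∀ w ∈ szSector (a' + b') (((a' : ℝ) - b') / 2), Bᴴ *ᵥ w ∈ szSector (a + b) (((a : ℝ) - b) / 2))
    {s q : ℝ} (hq : Real.exp (s - 1) ≤ q) :
    0 ≤ ∑ c, Real.exp (-(β * sectorEigenvalue (spinConfig a b) (hubbardTorusTT' L t t' U)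
          (hubbardTorusTT'_isHermitian L t t' U) c)) *
        (star ((fockTranslate v).val *ᵥ sectorEigenvector (spinConfig a b) (hubbardTorusTT' L t t' U)
            (hubbardTorusTT'_isHermitian L t t' U) c) ⬝ᵥ
          ((((β : ℝ) : ℂ) • (Bᴴ * (hubbardTorusTT' L t t' U * B - B * hubbardTorusTT' L t t' U)) -
              ((s : ℝ) : ℂ) • (Bᴴ * B)) *ᵥ
            ((fockTranslate v).val *ᵥ sectorEigenvector (spinConfig a b) (hubbardTorusTT' L t t' U)
              (hubbardTorusTT'_isHermitian L t t' U) c))).re +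
      q * ∑ d, Real.exp (-(β * sectorEigenvalue (spinConfig a' b') (hubbardTorusTT' L t t' U)
          (hubbardTorusTT'_isHermitian L t t' U) d)) *
        (star ((fockTranslate v).val *ᵥ sectorEigenvector (spinConfig a' b') (hubbardTorusTT' L t t' U)
            (hubbardTorusTT'_isHermitian L t t' U) d) ⬝ᵥ
          ((B * Bᴴ) *ᵥ ((fockTranslate v).val *ᵥ sectorEigenvector (spinConfig a' b')
            (hubbardTorusTT' L t t' U) (hubbardTorusTT'_isHermitian L t t' U) d))).re :=
  sum_exp_mul_re_expect_twoSector_eeb_mulVec_nonneg (spinConfig a b) (spinConfig a' b')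
    (hubbardTorusTT'_isHermitian L t t' U)
    (fun s s' hs hs' => hubbardTorusTT'_apply_eq_zero_of_spinConfig L t t' U a b s s' hs hs')
    (fun s s' hs hs' => hubbardTorusTT'_apply_eq_zero_of_spinConfig L t t' U a' b' s s' hs hs')
    (fockTranslate_val_conjTranspose_mul_val_mul L v) (fockTranslate_val_mul_val_conjTranspose_mul L v)
    (fockTranslate_commute_hubbardTorusTT' L v t t' U)
    (fun s s' hs hs' => fockTranslate_apply_eq_zero_of_spinConfig L v a b s s' hs hs')
    (fun s s' hs hs' => fockTranslate_conjTranspose_apply_eq_zero_of_spinConfig L v a b s s' hs hs')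
    (fun s s' hs hs' => fockTranslate_apply_eq_zero_of_spinConfig L v a' b' s s' hs hs')
    (fun s s' hs hs' => fockTranslate_conjTranspose_apply_eq_zero_of_spinConfig L v a' b' s s' hs hs')
    (fun s s' hs hs' => apply_eq_zero_of_spinConfig_of_mulVec_mem L hB s s' hs hs')
    (fun s s' hs hs' => apply_eq_zero_of_spinConfig_of_mulVec_mem L hB' s s' hs hs') β hq

omit [NeZero L] in
/-- **The untranslated rows** (`U_v` absent): the two-sector rows for the canonical Gibbs eigen-mixtures
of the two spin sectors themselves. [cite: FawziFawziScalet2024, Thm. 3.1]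
[cite: BratteliRobinsonII1997, Thm. 5.3.15] -/
theorem sum_exp_mul_re_expect_twoSector_eeb_torus_nonneg (t t' U β : ℝ) {a b a' b' : ℕ}
    {B : Matrix (Finset (Orb (FermionTorus 2 L))) (Finset (Orb (FermionTorus 2 L))) ℂ}
    (hB : ∀ w ∈ szSector (a + b) (((a : ℝ) - b) / 2), B *ᵥ w ∈ szSector (a' + b') (((a' : ℝ) - b') / 2))
    (hB' : ∀ w ∈ szSector (a' + b') (((a' : ℝ) - b') / 2), Bᴴ *ᵥ w ∈ szSector (a + b) (((a : ℝ) - b) / 2))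
    {s q : ℝ} (hq : Real.exp (s - 1) ≤ q) :
    0 ≤ ∑ c, Real.exp (-(β * sectorEigenvalue (spinConfig a b) (hubbardTorusTT' L t t' U)
          (hubbardTorusTT'_isHermitian L t t' U) c)) *
        (star (sectorEigenvector (spinConfig a b) (hubbardTorusTT' L t t' U)
            (hubbardTorusTT'_isHermitian L t t' U) c) ⬝ᵥ
          ((((β : ℝ) : ℂ) • (Bᴴ * (hubbardTorusTT' L t t' U * B - B * hubbardTorusTT' L t t' U)) -
              ((s : ℝ) : ℂ) • (Bᴴ * B)) *ᵥ
            sectorEigenvector (spinConfig a b) (hubbardTorusTT' L t t' U)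
              (hubbardTorusTT'_isHermitian L t t' U) c)).re +
      q * ∑ d, Real.exp (-(β * sectorEigenvalue (spinConfig a' b') (hubbardTorusTT' L t t' U)
          (hubbardTorusTT'_isHermitian L t t' U) d)) *
        (star (sectorEigenvector (spinConfig a' b') (hubbardTorusTT' L t t' U)
            (hubbardTorusTT'_isHermitian L t t' U) d) ⬝ᵥ
          ((B * Bᴴ) *ᵥ sectorEigenvector (spinConfig a' b') (hubbardTorusTT' L t t' U)
            (hubbardTorusTT'_isHermitian L t t' U) d)).re :=
  sum_exp_mul_re_expect_twoSector_eeb_nonneg (spinConfig a b) (spinConfig a' b')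
    (hubbardTorusTT'_isHermitian L t t' U)
    (fun s s' hs hs' => hubbardTorusTT'_apply_eq_zero_of_spinConfig L t t' U a b s s' hs hs')
    (fun s s' hs hs' => hubbardTorusTT'_apply_eq_zero_of_spinConfig L t t' U a' b' s s' hs hs')
    (fun s s' hs hs' => apply_eq_zero_of_spinConfig_of_mulVec_mem L hB s s' hs hs')
    (fun s s' hs hs' => apply_eq_zero_of_spinConfig_of_mulVec_mem L hB' s s' hs hs') β hq

omit [NeZero L] in
/-- **The normalised two-sector row, with the ratio of canonical partition functions.** With the
canonical weights `w_c = e^{−βE_c}/Z_{(a,b)}`, `w'_d = e^{−βE'_d}/Z_{(a',b')}` and the canonical partition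
functions `Z_{(a,b)} = Σ_c e^{−βE_c}` (`= Re Z_β(H_L|_{(a,b)})`, `partitionFn_spinSectorHamiltonian_re`), for
`e^{s−1} ≤ q`:
`0 ≤ Σ_c w_c Re⟨ψ_c, (β·Bᴴ(H_L B − B H_L) − s·BᴴB) ψ_c⟩ + q·(Z_{(a',b')}/Z_{(a,b)})·Σ_d w'_d Re⟨ψ'_d, BBᴴψ'_d⟩`
— the grand-canonical row of a charged generator with `e^{βμ}` replaced by `Z_{(a',b')}/Z_{(a,b)}`, the
exponential of the CANONICAL chemical potential of the charge `B` removes, and `BBᴴ` read in the image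
sector. [cite: BratteliRobinsonII1997, §5.4.2] [cite: FawziFawziScalet2024, Thm. 3.1] -/
theorem sum_canonicalWeight_mul_re_expect_twoSector_eeb_torus_nonneg (t t' U β : ℝ) {a b a' b' : ℕ}
    {B : Matrix (Finset (Orb (FermionTorus 2 L))) (Finset (Orb (FermionTorus 2 L))) ℂ}
    (hB : ∀ w ∈ szSector (a + b) (((a : ℝ) - b) / 2), B *ᵥ w ∈ szSector (a' + b') (((a' : ℝ) - b') / 2))
    (hB' : ∀ w ∈ szSector (a' + b') (((a' : ℝ) - b') / 2), Bᴴ *ᵥ w ∈ szSector (a + b) (((a : ℝ) - b) / 2))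
    {s q : ℝ} (hq : Real.exp (s - 1) ≤ q) :
    0 ≤ ∑ c, canonicalWeight β (sectorEigenvalue (spinConfig a b) (hubbardTorusTT' L t t' U)
          (hubbardTorusTT'_isHermitian L t t' U)) c *
        (star (sectorEigenvector (spinConfig a b) (hubbardTorusTT' L t t' U)
            (hubbardTorusTT'_isHermitian L t t' U) c) ⬝ᵥ
          ((((β : ℝ) : ℂ) • (Bᴴ * (hubbardTorusTT' L t t' U * B - B * hubbardTorusTT' L t t' U)) -
              ((s : ℝ) : ℂ) • (Bᴴ * B)) *ᵥ
            sectorEigenvector (spinConfig a b) (hubbardTorusTT' L t t' U)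
              (hubbardTorusTT'_isHermitian L t t' U) c)).re +
      q * ((∑ d, Real.exp (-(β * sectorEigenvalue (spinConfig a' b') (hubbardTorusTT' L t t' U)
              (hubbardTorusTT'_isHermitian L t t' U) d))) /
            ∑ c, Real.exp (-(β * sectorEigenvalue (spinConfig a b) (hubbardTorusTT' L t t' U)
              (hubbardTorusTT'_isHermitian L t t' U) c))) *
        ∑ d, canonicalWeight β (sectorEigenvalue (spinConfig a' b') (hubbardTorusTT' L t t' U)
          (hubbardTorusTT'_isHermitian L t t' U)) d *
          (star (sectorEigenvector (spinConfig a' b') (hubbardTorusTT' L t t' U)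
              (hubbardTorusTT'_isHermitian L t t' U) d) ⬝ᵥ
            ((B * Bᴴ) *ᵥ sectorEigenvector (spinConfig a' b') (hubbardTorusTT' L t t' U)
              (hubbardTorusTT'_isHermitian L t t' U) d)).re := by
  have h := sum_canonicalWeight_mul_re_expect_twoSector_eeb_nonneg (spinConfig a b) (spinConfig a' b')
    (hubbardTorusTT'_isHermitian L t t' U)
    (fun s s' hs hs' => hubbardTorusTT'_apply_eq_zero_of_spinConfig L t t' U a b s s' hs hs')
    (fun s s' hs hs' => hubbardTorusTT'_apply_eq_zero_of_spinConfig L t t' U a' b' s s' hs hs')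
    (fun s s' hs hs' => apply_eq_zero_of_spinConfig_of_mulVec_mem L hB s s' hs hs')
    (fun s s' hs hs' => apply_eq_zero_of_spinConfig_of_mulVec_mem L hB' s s' hs hs') β hq
  exact h

/-! ### §3 Brackets on the canonical chemical potential `β⁻¹ log(Z_{(a',b')}/Z_{(a,b)})` -/

omit [NeZero L] in
/-- **Lower bracket**: with `x = Σ_c w_c Re⟨ψ_c, BᴴBψ_c⟩ > 0`, `y' = Σ_d w'_d Re⟨ψ'_d, BBᴴψ'_d⟩ > 0` and
`h = Σ_c w_c Re⟨ψ_c, Bᴴ(H_L B − B H_L)ψ_c⟩`: `log(x/y') − β·h/x ≤ log(Z_{(a',b')}/Z_{(a,b)})`. For the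
single annihilator `B = c_{xσ}` one has `BᴴB = n_{xσ}`, `BBᴴ = 1 − n_{xσ}`, so `x`, `y'` are exact
sector densities and `h` is a kinetic/double-occupancy moment of the sector `(a, b)`.
[cite: BratteliRobinsonII1997, §5.4.2] [cite: FawziFawziScalet2024, Thm. 3.1] -/
theorem log_div_sub_div_le_log_partitionFn_ratio_torus (t t' U β : ℝ) {a b a' b' : ℕ}
    {B : Matrix (Finset (Orb (FermionTorus 2 L))) (Finset (Orb (FermionTorus 2 L))) ℂ}
    (hB : ∀ w ∈ szSector (a + b) (((a : ℝ) - b) / 2), B *ᵥ w ∈ szSector (a' + b') (((a' : ℝ) - b') / 2))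
    (hB' : ∀ w ∈ szSector (a' + b') (((a' : ℝ) - b') / 2), Bᴴ *ᵥ w ∈ szSector (a + b) (((a : ℝ) - b) / 2))
    (hx : 0 < ∑ c, canonicalWeight β (sectorEigenvalue (spinConfig a b) (hubbardTorusTT' L t t' U)
          (hubbardTorusTT'_isHermitian L t t' U)) c *
        (star (sectorEigenvector (spinConfig a b) (hubbardTorusTT' L t t' U)
            (hubbardTorusTT'_isHermitian L t t' U) c) ⬝ᵥ
          ((Bᴴ * B) *ᵥ sectorEigenvector (spinConfig a b) (hubbardTorusTT' L t t' U)
            (hubbardTorusTT'_isHermitian L t t' U) c)).re)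
    (hy : 0 < ∑ d, canonicalWeight β (sectorEigenvalue (spinConfig a' b') (hubbardTorusTT' L t t' U)
          (hubbardTorusTT'_isHermitian L t t' U)) d *
        (star (sectorEigenvector (spinConfig a' b') (hubbardTorusTT' L t t' U)
            (hubbardTorusTT'_isHermitian L t t' U) d) ⬝ᵥ
          ((B * Bᴴ) *ᵥ sectorEigenvector (spinConfig a' b') (hubbardTorusTT' L t t' U)
            (hubbardTorusTT'_isHermitian L t t' U) d)).re) :
    Real.log ((∑ c, canonicalWeight β (sectorEigenvalue (spinConfig a b) (hubbardTorusTT' L t t' U)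
            (hubbardTorusTT'_isHermitian L t t' U)) c *
          (star (sectorEigenvector (spinConfig a b) (hubbardTorusTT' L t t' U)
              (hubbardTorusTT'_isHermitian L t t' U) c) ⬝ᵥ
            ((Bᴴ * B) *ᵥ sectorEigenvector (spinConfig a b) (hubbardTorusTT' L t t' U)
              (hubbardTorusTT'_isHermitian L t t' U) c)).re) /
        ∑ d, canonicalWeight β (sectorEigenvalue (spinConfig a' b') (hubbardTorusTT' L t t' U)
            (hubbardTorusTT'_isHermitian L t t' U)) d *
          (star (sectorEigenvector (spinConfig a' b') (hubbardTorusTT' L t t' U)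
              (hubbardTorusTT'_isHermitian L t t' U) d) ⬝ᵥ
            ((B * Bᴴ) *ᵥ sectorEigenvector (spinConfig a' b') (hubbardTorusTT' L t t' U)
              (hubbardTorusTT'_isHermitian L t t' U) d)).re) -
      β * (∑ c, canonicalWeight β (sectorEigenvalue (spinConfig a b) (hubbardTorusTT' L t t' U)
            (hubbardTorusTT'_isHermitian L t t' U)) c *
          (star (sectorEigenvector (spinConfig a b) (hubbardTorusTT' L t t' U)
              (hubbardTorusTT'_isHermitian L t t' U) c) ⬝ᵥ
            ((Bᴴ * (hubbardTorusTT' L t t' U * B - B * hubbardTorusTT' L t t' U)) *ᵥ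
              sectorEigenvector (spinConfig a b) (hubbardTorusTT' L t t' U)
                (hubbardTorusTT'_isHermitian L t t' U) c)).re) /
        (∑ c, canonicalWeight β (sectorEigenvalue (spinConfig a b) (hubbardTorusTT' L t t' U)
            (hubbardTorusTT'_isHermitian L t t' U)) c *
          (star (sectorEigenvector (spinConfig a b) (hubbardTorusTT' L t t' U)
              (hubbardTorusTT'_isHermitian L t t' U) c) ⬝ᵥ
            ((Bᴴ * B) *ᵥ sectorEigenvector (spinConfig a b) (hubbardTorusTT' L t t' U)
              (hubbardTorusTT'_isHermitian L t t' U) c)).re) ≤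
      Real.log ((∑ d, Real.exp (-(β * sectorEigenvalue (spinConfig a' b') (hubbardTorusTT' L t t' U)
            (hubbardTorusTT'_isHermitian L t t' U) d))) /
        ∑ c, Real.exp (-(β * sectorEigenvalue (spinConfig a b) (hubbardTorusTT' L t t' U)
            (hubbardTorusTT'_isHermitian L t t' U) c))) := by
  have h := log_div_sub_div_le_log_partitionRatio (spinConfig a b) (spinConfig a' b')
    (hubbardTorusTT'_isHermitian L t t' U)
    (fun s s' hs hs' => hubbardTorusTT'_apply_eq_zero_of_spinConfig L t t' U a b s s' hs hs')
    (fun s s' hs hs' => hubbardTorusTT'_apply_eq_zero_of_spinConfig L t t' U a' b' s s' hs hs')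
    (fun s s' hs hs' => apply_eq_zero_of_spinConfig_of_mulVec_mem L hB s s' hs hs')
    (fun s s' hs hs' => apply_eq_zero_of_spinConfig_of_mulVec_mem L hB' s s' hs hs') β hx hy
  exact h

omit [NeZero L] in
/-- **Upper bracket**: `log(Z_{(a',b')}/Z_{(a,b)}) ≤ log(x/y') + β·g'/y'`,
`g' = Σ_d w'_d Re⟨ψ'_d, B(H_L Bᴴ − Bᴴ H_L)ψ'_d⟩` — the same row read from the image sector with the adjoint
generator. [cite: BratteliRobinsonII1997, §5.4.2] [cite: FawziFawziScalet2024, Thm. 3.1] -/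
theorem log_partitionFn_ratio_le_log_div_add_div_torus (t t' U β : ℝ) {a b a' b' : ℕ}
    {B : Matrix (Finset (Orb (FermionTorus 2 L))) (Finset (Orb (FermionTorus 2 L))) ℂ}
    (hB : ∀ w ∈ szSector (a + b) (((a : ℝ) - b) / 2), B *ᵥ w ∈ szSector (a' + b') (((a' : ℝ) - b') / 2))
    (hB' : ∀ w ∈ szSector (a' + b') (((a' : ℝ) - b') / 2), Bᴴ *ᵥ w ∈ szSector (a + b) (((a : ℝ) - b) / 2))
    (hx : 0 < ∑ c, canonicalWeight β (sectorEigenvalue (spinConfig a b) (hubbardTorusTT' L t t' U)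
          (hubbardTorusTT'_isHermitian L t t' U)) c *
        (star (sectorEigenvector (spinConfig a b) (hubbardTorusTT' L t t' U)
            (hubbardTorusTT'_isHermitian L t t' U) c) ⬝ᵥ
          ((Bᴴ * B) *ᵥ sectorEigenvector (spinConfig a b) (hubbardTorusTT' L t t' U)
            (hubbardTorusTT'_isHermitian L t t' U) c)).re)
    (hy : 0 < ∑ d, canonicalWeight β (sectorEigenvalue (spinConfig a' b') (hubbardTorusTT' L t t' U)
          (hubbardTorusTT'_isHermitian L t t' U)) d *
        (star (sectorEigenvector (spinConfig a' b') (hubbardTorusTT' L t t' U)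
            (hubbardTorusTT'_isHermitian L t t' U) d) ⬝ᵥ
          ((B * Bᴴ) *ᵥ sectorEigenvector (spinConfig a' b') (hubbardTorusTT' L t t' U)
            (hubbardTorusTT'_isHermitian L t t' U) d)).re) :
    Real.log ((∑ d, Real.exp (-(β * sectorEigenvalue (spinConfig a' b') (hubbardTorusTT' L t t' U)
            (hubbardTorusTT'_isHermitian L t t' U) d))) /
        ∑ c, Real.exp (-(β * sectorEigenvalue (spinConfig a b) (hubbardTorusTT' L t t' U)
            (hubbardTorusTT'_isHermitian L t t' U) c))) ≤
      Real.log ((∑ c, canonicalWeight β (sectorEigenvalue (spinConfig a b) (hubbardTorusTT' L t t' U)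
            (hubbardTorusTT'_isHermitian L t t' U)) c *
          (star (sectorEigenvector (spinConfig a b) (hubbardTorusTT' L t t' U)
              (hubbardTorusTT'_isHermitian L t t' U) c) ⬝ᵥ
            ((Bᴴ * B) *ᵥ sectorEigenvector (spinConfig a b) (hubbardTorusTT' L t t' U)
              (hubbardTorusTT'_isHermitian L t t' U) c)).re) /
        ∑ d, canonicalWeight β (sectorEigenvalue (spinConfig a' b') (hubbardTorusTT' L t t' U)
            (hubbardTorusTT'_isHermitian L t t' U)) d *
          (star (sectorEigenvector (spinConfig a' b') (hubbardTorusTT' L t t' U)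
              (hubbardTorusTT'_isHermitian L t t' U) d) ⬝ᵥ
            ((B * Bᴴ) *ᵥ sectorEigenvector (spinConfig a' b') (hubbardTorusTT' L t t' U)
              (hubbardTorusTT'_isHermitian L t t' U) d)).re) +
      β * (∑ d, canonicalWeight β (sectorEigenvalue (spinConfig a' b') (hubbardTorusTT' L t t' U)
            (hubbardTorusTT'_isHermitian L t t' U)) d *
          (star (sectorEigenvector (spinConfig a' b') (hubbardTorusTT' L t t' U)
              (hubbardTorusTT'_isHermitian L t t' U) d) ⬝ᵥ
            ((B * (hubbardTorusTT' L t t' U * Bᴴ - Bᴴ * hubbardTorusTT' L t t' U)) *ᵥ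
              sectorEigenvector (spinConfig a' b') (hubbardTorusTT' L t t' U)
                (hubbardTorusTT'_isHermitian L t t' U) d)).re) /
        (∑ d, canonicalWeight β (sectorEigenvalue (spinConfig a' b') (hubbardTorusTT' L t t' U)
            (hubbardTorusTT'_isHermitian L t t' U)) d *
          (star (sectorEigenvector (spinConfig a' b') (hubbardTorusTT' L t t' U)
              (hubbardTorusTT'_isHermitian L t t' U) d) ⬝ᵥ
            ((B * Bᴴ) *ᵥ sectorEigenvector (spinConfig a' b') (hubbardTorusTT' L t t' U)
              (hubbardTorusTT'_isHermitian L t t' U) d)).re) := by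
  have h := log_partitionRatio_le_log_div_add_div (spinConfig a b) (spinConfig a' b')
    (hubbardTorusTT'_isHermitian L t t' U)
    (fun s s' hs hs' => hubbardTorusTT'_apply_eq_zero_of_spinConfig L t t' U a b s s' hs hs')
    (fun s s' hs hs' => hubbardTorusTT'_apply_eq_zero_of_spinConfig L t t' U a' b' s s' hs hs')
    (fun s s' hs hs' => apply_eq_zero_of_spinConfig_of_mulVec_mem L hB s s' hs hs')
    (fun s s' hs hs' => apply_eq_zero_of_spinConfig_of_mulVec_mem L hB' s s' hs hs') β hx hy
  exact h

end Torus

end Literature.MathematicalPhysics.QuantumLattice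

end
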